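import Summits.ResolutionOfSingularities.ResolutionOfSingularities.Theorems.CleanCoversCoverResolutionLowDimension
import Literature.AlgebraicGeometry.Resolution.ResolutionProjectiveReduction
import Literature.AlgebraicGeometry.Resolution.KedlayaEtaleCoversProofs
import Literature.AlgebraicGeometry.Resolution.PrincipalizationToResolution
import HarnessLib

/-!
# Crux `CleanCovers.CoverResolution` (stmt-ResolutionOfSingularities-15104), line `strategy-split`
# v2.1: CERTIFICATES — the graded converses `CR(≤ d) → ResPerfect(dim ≤ d)`, `→ T(trdeg ≤ d)`,
# `→ L(≤ d)`

Route `ResolutionOfSingularities/CleanCovers`. Write `CR(≤ d)` for the crux `CoverResolution`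
(resolution of every Kedlaya cover `f : X → ℙⁿ_k`: `X` integral, `f` finite surjective and étale
over the chart `D₊(xₙ)`, `k` perfect of characteristic `p`) restricted to `n ≤ d`. This file is
the dimension-graded twin of `CleanCoversCoverResolutionLowDimension.lean`, with the hypothesis
`CR(≤ d)` in place of the named fact `CossartPiltant2019`:

* `resolutionOverUpToDim_of_coverResolution_dimLe`: `CR(≤ d)` gives weak resolution of every
  reduced separated finite-type scheme of dimension `≤ d` over every perfect field `k` of
  characteristic `p` (`ResolutionOverUpToDim k d`). By the tree's projective reduction
  `ResolutionOverUpToDim.of_projective` (irreducible components, Chow's lemma, projective closure)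
  it suffices to resolve the integral closed subschemes `X ⊆ ℙᴺ_k` with `dim X ≤ d`; Kedlaya's
  theorem (`Kedlaya2004_finite_etale_off_hyperplane_holds`, PROVED in the tree, applied to the
  closed immersion, which is finite) makes such an `X` a Kedlaya cover of some `ℙⁿ_k`; then
  `dim X = n` (`topologicalKrullDim_eq_of_kedlayaCover`), so `n ≤ d` and `CR(≤ d)` resolves `X`.
* `twoModelPatchingPerfect_trdegLe_of_coverResolution_dimLe`: hence Zariski two-model patching of
  proper models over perfect fields of characteristic `p` in transcendence degree `≤ d`
  (`stub_twoModelPatchingAt_of_resolvable_dimLe`, fed with the previous item on integral — hence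
  reduced — `k`-schemes of dimension `≤ d`).
* `boundaryLocalResolution_dimLe_of_coverResolution_dimLe`: `CR(≤ d) → L(≤ d)` (local resolution
  along the hyperplane at infinity, graded): take `B = ⊤` and restrict the resolution of `X` to
  `f⁻¹(⊤)` (`Scheme.HasResolution.restrict`).

## References

* K. S. Kedlaya, *More étale covers of affine spaces in positive characteristic*, J. Algebraic
  Geom. 14 (2005), 187–192, Thm. 1. [Kedlaya2004]
* V. Cossart, O. Piltant, *Resolution of singularities of arithmetical threefolds*, J. Algebra 529
  (2019) 268–535, proof of Prop. 4.6, Steps 1–3 (projective reduction). [CossartPiltant2019]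
* O. Zariski, P. Samuel, *Commutative Algebra* II, Ch. VI §17 (joins of models). [ZariskiSamuel1960]
-/

-- single-problem summit: the doubled namespace component `ResolutionOfSingularities` is forced
set_option linter.dupNamespace false

noncomputable section

namespace Summit.ResolutionOfSingularities.ResolutionOfSingularities.Theorems

open CategoryTheory AlgebraicGeometry TopologicalSpace
open Literature.AlgebraicGeometry.Resolution

/-! ## `CR(≤ d)` resolves everything of dimension `≤ d` over perfect fields -/

/-- **`CR(≤ d)` gives `ResolutionOverUpToDim k d` for every perfect field `k` of characteristic
`p`.** By `ResolutionOverUpToDim.of_projective` it suffices to resolve integral closed subschemes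
`X ⊆ ℙᴺ_k` of dimension `≤ d`; by Kedlaya's theorem
(`Kedlaya2004_finite_etale_off_hyperplane_holds`, the closed immersion being finite) such an `X`
is a finite surjective cover of some `ℙⁿ_k` étale over `D₊(xₙ)`, of dimension `n`
(`topologicalKrullDim_eq_of_kedlayaCover`), so `n ≤ d` and the hypothesis resolves `X`.
[cite: Kedlaya2004, Thm. 1] -/
theorem resolutionOverUpToDim_of_coverResolution_dimLe : ∀ d : ℕ, (∀ p : ℕ, p.Prime → ∀ (k : Type) [Field k] [CharP k p] [PerfectField k] (n : ℕ) (X : AlgebraicGeometry.Scheme.{0}) (f : X ⟶ (Literature.AlgebraicGeometry.Motives.projectiveSpace n k).left), AlgebraicGeometry.IsIntegral X → AlgebraicGeometry.IsFinite f → Function.Surjective f.base → (letI := MvPolynomial.gradedAlgebra (σ := Fin (n + 1)) (R := k); AlgebraicGeometry.Etale (f ∣_ (AlgebraicGeometry.Proj.basicOpen (MvPolynomial.homogeneousSubmodule (Fin (n + 1)) k) (MvPolynomial.X (Fin.last n))))) → n ≤ d → Literature.AlgebraicGeometry.Resolution.Scheme.HasResolution X) → ∀ p : ℕ, p.Prime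 → ∀ (k : Type) [Field k] [CharP k p] [PerfectField k], Literature.AlgebraicGeometry.Resolution.ResolutionOverUpToDim k d := by
  intro d hC p hp k _ _ _
  refine ResolutionOverUpToDim.of_projective (k := k) (d := d) fun N X ι hι hint hdim => ?_
  haveI := hι
  haveI := hint
  obtain ⟨n, f, -, hfin, hsurj, het⟩ :=
    Kedlaya2004_finite_etale_off_hyperplane_holds p hp k N X ι hint inferInstance
  haveI := hfin
  have hn : n ≤ d := by
    have h := hdim
    rw [topologicalKrullDim_eq_of_kedlayaCover k n X f hsurj] at h
    exact_mod_cast h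
  exact hC p hp k n X f hint hfin hsurj het hn

/-! ## `CR(≤ d)` gives two-model patching over perfect fields in transcendence degree `≤ d` -/

/-- **`CR(≤ d)` gives T (two-model patching of proper models over perfect fields of
characteristic `p`) for `trdeg_k K ≤ d`.** By `stub_twoModelPatchingAt_of_resolvable_dimLe`
(resolve the join `M₁ ⋈ M₂`, a proper model of dimension `trdeg_k K ≤ d`) it suffices to resolve
integral separated finite-type `k`-schemes of dimension `≤ d`, which
`resolutionOverUpToDim_of_coverResolution_dimLe` does (integral schemes are reduced).
[cite: ZariskiSamuel1960, Ch. VI §17 (joins of models)] -/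
theorem twoModelPatchingPerfect_trdegLe_of_coverResolution_dimLe : ∀ d : ℕ, (∀ p : ℕ, p.Prime → ∀ (k : Type) [Field k] [CharP k p] [PerfectField k] (n : ℕ) (X : AlgebraicGeometry.Scheme.{0}) (f : X ⟶ (Literature.AlgebraicGeometry.Motives.projectiveSpace n k).left), AlgebraicGeometry.IsIntegral X → AlgebraicGeometry.IsFinite f → Function.Surjective f.base → (letI := MvPolynomial.gradedAlgebra (σ := Fin (n + 1)) (R := k); AlgebraicGeometry.Etale (f ∣_ (AlgebraicGeometry.Proj.basicOpen (MvPolynomial.homogeneousSubmodule (Fin (n + 1)) k) (MvPolynomial.X (Fin.last n))))) → n ≤ d → Literature.AlgebraicGeometry.Resolution.Scheme.HasResolution X) → (∀ p : ℕ, p.Prime → ∀ (k : Type) [Field k] [CharP k p] [PerfectField k] (K : Type) [Field K] [Algebra k K] [Algebra.EssFiniteType k K], Algebra.trdeg k K ≤ d → ∀ (M₁ M₂ : Literature.AlgebraicGeometry.Resolution.ProperModel k K), ∃ (N : Literature.AlgebraicGeometry.Resolution.ProperModel k K) (φ₁ : N.Hom M₁) (φ₂ : N.Hom M₂), φ₁.RegLe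 ∧ φ₂.RegLe) := by
  intro d hC p hp k _ _ _ K _ _ _ hK M₁ M₂
  refine stub_twoModelPatchingAt_of_resolvable_dimLe k d (fun X f hs hl hq hi hd => ?_) K
    (by exact_mod_cast hK) M₁ M₂
  haveI := hi
  exact resolutionOverUpToDim_of_coverResolution_dimLe d hC p hp k X f hs hl hq inferInstance hd

/-! ## `CR(≤ d)` gives L in dimension `≤ d` -/

/-- **`CR(≤ d) → L(≤ d)` (local resolution along the hyperplane at infinity, graded by the
dimension).** Under `CR(≤ d)` the whole Kedlaya cover `X` (with `n ≤ d`) is resolvable; take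
`B = ⊤` and restrict the resolution to the open `f⁻¹(⊤)` (`Scheme.HasResolution.restrict`).
[folklore] -/
theorem boundaryLocalResolution_dimLe_of_coverResolution_dimLe : ∀ d : ℕ, (∀ p : ℕ, p.Prime → ∀ (k : Type) [Field k] [CharP k p] [PerfectField k] (n : ℕ) (X : AlgebraicGeometry.Scheme.{0}) (f : X ⟶ (Literature.AlgebraicGeometry.Motives.projectiveSpace n k).left), AlgebraicGeometry.IsIntegral X → AlgebraicGeometry.IsFinite f → Function.Surjective f.base → (letI := MvPolynomial.gradedAlgebra (σ := Fin (n + 1)) (R := k); AlgebraicGeometry.Etale (f ∣_ (AlgebraicGeometry.Proj.basicOpen (MvPolynomial.homogeneousSubmodule (Fin (n + 1)) k) (MvPolynomial.X (Fin.last n))))) → n ≤ d → Literature.AlgebraicGeometry.Resolution.Scheme.HasResolution X) → (∀ p : ℕ, p.Prime → ∀ (k : Type) [Field k] [CharP k p] [PerfectField k] (n : ℕ) (X : AlgebraicGeometry.Scheme.{0}) (f : X ⟶ (Literature.AlgebraicGeometry.Motives.projectiveSpace n k).left), AlgebraicGeometry.IsIntegral X → AlgebraicGeometry.IsFinite f →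 Function.Surjective f.base → (letI := MvPolynomial.gradedAlgebra (σ := Fin (n + 1)) (R := k); AlgebraicGeometry.Etale (f ∣_ (AlgebraicGeometry.Proj.basicOpen (MvPolynomial.homogeneousSubmodule (Fin (n + 1)) k) (MvPolynomial.X (Fin.last n))))) → n ≤ d → ∀ h : (Literature.AlgebraicGeometry.Motives.projectiveSpace n k).left, (letI := MvPolynomial.gradedAlgebra (σ := Fin (n + 1)) (R := k); h ∉ AlgebraicGeometry.Proj.basicOpen (MvPolynomial.homogeneousSubmodule (Fin (n + 1)) k) (MvPolynomial.X (Fin.last n))) → ∃ B : (Literature.AlgebraicGeometry.Motives.projectiveSpace n k).left.Opens, h ∈ B ∧ Literature.AlgebraicGeometry.Resolution.Scheme.HasResolution ((f ⁻¹ᵁ B : X.Opens) : AlgebraicGeometry.Scheme.{0})) := by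
  intro d hC p hp k _ _ _ n X f hint hfin hsurj het hn _ _
  exact ⟨⊤, trivial, (hC p hp k n X f hint hfin hsurj het hn).restrict (f ⁻¹ᵁ ⊤)⟩

end Summit.ResolutionOfSingularities.ResolutionOfSingularities.Theorems

end
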